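import Mathlib
import HarnessLib
import Summits.NavierStokesRegularity.NavierStokesRegularity.Theses.RootDecompLitSlice
import Summits.NavierStokesRegularity.NavierStokesRegularity.Theorems.RootDecompLitSliceNoDarkBallCompositionModuloStub
import Summits.NavierStokesRegularity.NavierStokesRegularity.Theorems.RootDecompLitSliceDarkBallSpreadsTerminalSliceNullity
import Summits.NavierStokesRegularity.NavierStokesRegularity.Theorems.RootDecompLitSliceDarkBallSpreadsComplConnected
import Summits.NavierStokesRegularity.NavierStokesRegularity.Theorems.RootDecompLitSliceDarkBallSpreadsSliceIdentification
import Summits.NavierStokesRegularity.NavierStokesRegularity.Theorems.RootDecompLitSliceDarkBallSpreadsCurlFreeHarmonic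
import Summits.NavierStokesRegularity.NavierStokesRegularity.Theorems.RootDecompLitSliceDarkBallSpreadsPropagation
import Summits.NavierStokesRegularity.NavierStokesRegularity.Theorems.RootDecompLitSliceDarkBallSpreadsTerminalField

/-!
# Route RootDecompLitSlice — ASSEMBLY of the aside D₁ `DarkBallSpreads` (stmt-NavierStokesRegularity-29566)
  and of crux D `NoDarkBall` (stmt-NavierStokesRegularity-29563) MODULO THE LOCAL SPREAD STEP

The brick ledger of D₁ (census E20/E21; bus L1177–L1193) is now in the tree except for its analytic
core: B0 `hausdorffMeasure_terminal_backwardSingularSlice_eq_zero` (ℋ¹-nullity of the backward-singular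
terminal slice `Σ_T`), B1 `regularPoint_iteratedFDeriv_bounds` + B1′ `terminalField_of_classical_lerayHopf`
(the smooth terminal field `w` on `Σ_Tᶜ` with local uniform `C¹` convergence and `div w = 0`), B2
`lerayHopf_ae_eq_restrict_of_tendstoLocallyUniformlyOn` / `lerayHopf_limit_eqOn_zero_of_darkBall`
(`u T = w` a.e. on `Σ_Tᶜ`; `w = 0` on the dark ball), B5 (+ complement: `Σ_T` closed, `Σ_Tᶜ`
path-connected), PROPAGATION `curl_eq_zero_compl_backwardSingularSlice_of_darkBall` (irrotationality
spreads along `Σ_Tᶜ` from the dark ball GIVEN the local spread step), and the tail B6′/B6″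
`ae_eq_zero_of_ae_eq_curlFree_divFree_off_backwardSingularSlice_of_darkBall` (curl-free + div-free off a
closed `ℋ¹`-null set + dark ball ⟹ a.e. zero).

This file composes them: `darkBallSpreads_of_localSpread` proves the route's aside
`Theses.RootDecompLitSlice.DarkBallSpreads` BY NAME from ONE hypothesis, the **LOCAL SPREAD STEP**
(stated inline, no new definition):

  for every Clay-class solution `(u, p)` on `[0, T)` (classical, Leray–Hopf on `[0, T]`, rapidly
  decaying datum, `ν, T > 0`) and every field `w` that is the pointwise limit of `u t` on `Σ_Tᶜ` as
  `t → T⁻`: every regular `x₀` has a radius `ρ > 0` such that, for every regular `x₁` with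
  `dist x₁ x₀ < ρ`, if `curl w` vanishes near `x₁` then it vanishes near `x₀`

— which is bricks B3 (flatness of `curl w` near `x₁` ⟹ vanishing of the vorticity to infinite parabolic
order at `(T, x₁)`, pressure-free induction on the vorticity equation with B1's bounds) + B4 (the PROVED
backward uniqueness / unique continuation `Literature.Analysis.FluidPDE.ess_unique_continuation_holds`
on the time-reversed, translated, viscosity-normalised vorticity in the cylinder
`B_{r/2}(x₁) × (T − r²/4, T) ⊆ Q_r(T, x₀)`, `ρ := r/2`), both with the census (decomp-ns-census-1 g28,
bus L1191). Then `noDarkBall_of_localSpread` closes crux D through the census composition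
`noDarkBall_of_darkBallSpreads` (p798859): once a Theorems file proves the local spread step, D₁ and D
close by two one-line files.

HONEST FRAMING: composition only; closes no item by itself; D is an expected theorem and every D₁
brick is DECORATIVE for the summit per D-0179 (the summit-hard leaves are N16's residual U 29565 /
N20's M₂); nothing here bears on NS regularity (rung 0). Lands
`--supports stmt-NavierStokesRegularity-29566 --as helper` (decomp-ns route-writer g16). [folklore]
-/

noncomputable section

open MeasureTheory Set Function Filter Topology Metric
open scoped ENNReal NNReal ContDiff
open Literature.Analysis.FluidPDE

-- the summit and its single sub-problem share the name (CONVENTIONS §1), as in every Theorems file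
set_option linter.dupNamespace false

namespace Summit.NavierStokesRegularity.NavierStokesRegularity.Theorems

open Summit.NavierStokesRegularity.NavierStokesRegularity.Theses.RootDecompLitSlice

/-- **D₁ `DarkBallSpreads` from the local spread step.** See the module docstring for the brick map;
the hypothesis is the local spread step for `curl` of the terminal field on the regular slice, the
conclusion is the route decl `Theses.RootDecompLitSlice.DarkBallSpreads` by name. [folklore] -/
theorem darkBallSpreads_of_localSpread
    (hLS : ∀ (ν T : ℝ), 0 < ν → 0 < T →
      ∀ (u : ℝ → EuclideanSpace ℝ (Fin 3) → EuclideanSpace ℝ (Fin 3))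
        (p : ℝ → EuclideanSpace ℝ (Fin 3) → ℝ),
      IsClassicalNSSolutionOn (Ico 0 T) ν 0 u p → IsLerayHopfOn T ν 0 (u 0) u →
      HasRapidSpatialDecay (u 0) →
      ∀ w : EuclideanSpace ℝ (Fin 3) → EuclideanSpace ℝ (Fin 3),
        (∀ y ∈ {x : EuclideanSpace ℝ (Fin 3) | IsBackwardSingularPoint u (T, x)}ᶜ,
          Tendsto (fun t => u t y) (𝓝[<] T) (𝓝 (w y))) →
        ∀ x₀ ∈ {x : EuclideanSpace ℝ (Fin 3) | IsBackwardSingularPoint u (T, x)}ᶜ, ∃ ρ > 0,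
          ∀ x₁ ∈ {x : EuclideanSpace ℝ (Fin 3) | IsBackwardSingularPoint u (T, x)}ᶜ, dist x₁ x₀ < ρ →
            (∀ᶠ y in 𝓝 x₁, curl w y = 0) → ∀ᶠ y in 𝓝 x₀, curl w y = 0) :
    DarkBallSpreads := by
  intro ν T hν hT u p hmax hLH hdec x₀ ρ hρ hdark
  have hsol : IsClassicalNSSolutionOn (Ico 0 T) ν 0 u p := hmax.1
  -- B0: the backward-singular terminal slice is `ℋ¹`-null
  have hnull : μH[1] {x : EuclideanSpace ℝ (Fin 3) | IsBackwardSingularPoint u ((T : ℝ), x)} = 0 :=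
    hausdorffMeasure_terminal_backwardSingularSlice_eq_zero hν hT hsol hLH hdec
  -- B5 complement: the regular slice is open
  have hV : IsOpen {x : EuclideanSpace ℝ (Fin 3) | IsBackwardSingularPoint u ((T : ℝ), x)}ᶜ :=
    (isClosed_backwardSingularSlice u T).isOpen_compl
  -- B1 + B1′: the terminal field
  obtain ⟨w, hpt, hCD, hloc, -, hdiv⟩ := terminalField_of_classical_lerayHopf hν hT hsol hLH hdec
  have hwcont : ContinuousOn w {x : EuclideanSpace ℝ (Fin 3) | IsBackwardSingularPoint u ((T : ℝ), x)}ᶜ :=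
    hCD.continuousOn
  have hw2 : ContDiffOn ℝ 2 w {x : EuclideanSpace ℝ (Fin 3) | IsBackwardSingularPoint u ((T : ℝ), x)}ᶜ :=
    hCD.of_le (by norm_cast)
  -- B2: the energy-class slice `u T` is `w` a.e. on the regular slice; `w = 0` on the dark ball
  have hvw : ∀ᵐ x ∂(volume.restrict {x : EuclideanSpace ℝ (Fin 3) | IsBackwardSingularPoint u ((T : ℝ), x)}ᶜ),
      u T x = w x :=
    lerayHopf_ae_eq_restrict_of_tendstoLocallyUniformlyOn hT hLH hV hwcont hloc
  have hdark' : EqOn w 0 (ball x₀ ρ ∩ {x : EuclideanSpace ℝ (Fin 3) | IsBackwardSingularPoint u ((T : ℝ), x)}ᶜ) :=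
    lerayHopf_limit_eqOn_zero_of_darkBall hT hLH hV hwcont hloc hdark
  -- PROPAGATION + the local spread step: `curl w = 0` on the whole regular slice
  have hcurl : ∀ x ∈ {x : EuclideanSpace ℝ (Fin 3) | IsBackwardSingularPoint u ((T : ℝ), x)}ᶜ,
      curl w x = 0 :=
    curl_eq_zero_compl_backwardSingularSlice_of_darkBall u T hnull
      (hLS ν T hν hT u p hsol hLH hdec w hpt) hρ hdark'
  -- B6′/B6″ tail
  exact ae_eq_zero_of_ae_eq_curlFree_divFree_off_backwardSingularSlice_of_darkBall u T hnull hw2 hcurl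
    hdiv hvw hρ hdark

/-- **Crux D `NoDarkBall` from the local spread step**, through the census composition
`noDarkBall_of_darkBallSpreads` (D₂ `NoGlobalExtinction` is landed). [folklore] -/
theorem noDarkBall_of_localSpread
    (hLS : ∀ (ν T : ℝ), 0 < ν → 0 < T →
      ∀ (u : ℝ → EuclideanSpace ℝ (Fin 3) → EuclideanSpace ℝ (Fin 3))
        (p : ℝ → EuclideanSpace ℝ (Fin 3) → ℝ),
      IsClassicalNSSolutionOn (Ico 0 T) ν 0 u p → IsLerayHopfOn T ν 0 (u 0) u →
      HasRapidSpatialDecay (u 0) →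
      ∀ w : EuclideanSpace ℝ (Fin 3) → EuclideanSpace ℝ (Fin 3),
        (∀ y ∈ {x : EuclideanSpace ℝ (Fin 3) | IsBackwardSingularPoint u (T, x)}ᶜ,
          Tendsto (fun t => u t y) (𝓝[<] T) (𝓝 (w y))) →
        ∀ x₀ ∈ {x : EuclideanSpace ℝ (Fin 3) | IsBackwardSingularPoint u (T, x)}ᶜ, ∃ ρ > 0,
          ∀ x₁ ∈ {x : EuclideanSpace ℝ (Fin 3) | IsBackwardSingularPoint u (T, x)}ᶜ, dist x₁ x₀ < ρ →
            (∀ᶠ y in 𝓝 x₁, curl w y = 0) → ∀ᶠ y in 𝓝 x₀, curl w y = 0) :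
    NoDarkBall :=
  NoDarkBall.noDarkBall_of_darkBallSpreads (darkBallSpreads_of_localSpread hLS)

end Summit.NavierStokesRegularity.NavierStokesRegularity.Theorems
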